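import Mathlib.Analysis.SpecialFunctions.Exp

/-!
# T⁴ programme, spine node NE2 (U1a), tier B — ROW B5 arithmetic: the transport size `τ(α) = e^{(d+1)α} − 1` of the determined site /
# contour transporters (`Support/RegularSiteTransporters`, `Support/RegularTransportersContour`) is LINEAR in the regularity parameter

NE2 formalisation swarm, leaf prover 03 (row B5).  ROOT B's t = 1 face (`Spine/NE2BalabanFinal.balaban_final_rate_of_small`, leaf-08) and
leaf-05's B4-slot threshold file (`Support/GaugeTermThreshold.gaugeSlot_small_of_le`, binders `0 ≤ τ ≤ η`) take the transport size
`τ = tauR d α = e^{(d+1)α} − 1` and `ε = epsR o d α = card o·τ` as numbers to be bounded by the smallness parameter `η`.  This file supplies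
the elementary bounds: **`exp_mul_sub_one_le`** (`0 ≤ α ≤ η`, `(d+1)η ≤ 1` ⟹ `e^{(d+1)α} − 1 ≤ 2(d+1)η`), `exp_mul_sub_one_le_two`,
`exp_mul_sub_one_nonneg`, and **`card_mul_exp_sub_one_le`** (`card o·(e^{(d+1)α} − 1) ≤ η·(2·card o·(d+1))`).  Mathlib only
(`Real.abs_exp_sub_one_le`); no project import, so every consumer can use it.

HONEST FRAMING (T4-DAG p. 1).  Elementary real inequalities; changes no mathematics; NE2 NOT proved; NOT infinite volume, NOT a mass gap, NOT
Clay, NOT summit progress; spine 0/9 unchanged.  HONEST DEPENDENCY: continuum YM on T⁴ ⇐ BetaPertH ∧ nine spine estimates (0/9 proved);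
BetaPertH ⇐ (D1) ∧ (D4) ∧ CAP+tail; G-an2-4 gates asym, D1 and NE2/3/4.  ABSOLUTE RULE kept; no `sorry`.
-/

namespace Summit.QuantumFields.BalabanUV.T4Continuum.RegularTransportSize

/-- `0 ≤ e^{(d+1)α} − 1` for `α ≥ 0`. [folklore] -/
theorem exp_mul_sub_one_nonneg (d : ℕ) {α : ℝ} (hα : 0 ≤ α) : 0 ≤ Real.exp ((d + 1 : ℕ) * α) - 1 :=
  sub_nonneg.mpr (Real.one_le_exp (by positivity))

/-- **THE TRANSPORT SIZE IS LINEAR IN THE REGULARITY PARAMETER**: `e^{(d+1)α} − 1 ≤ 2(d+1)η` when `0 ≤ α ≤ η` and `(d+1)η ≤ 1`. [folklore] -/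
theorem exp_mul_sub_one_le (d : ℕ) {α η : ℝ} (hα : 0 ≤ α) (hαη : α ≤ η) (hη : (d + 1 : ℝ) * η ≤ 1) :
    Real.exp ((d + 1 : ℕ) * α) - 1 ≤ 2 * ((d + 1 : ℝ) * η) := by
  have hd : (0 : ℝ) ≤ d + 1 := by positivity
  have h1 : ((d + 1 : ℕ) : ℝ) * α ≤ (d + 1 : ℝ) * η := by push_cast; exact mul_le_mul_of_nonneg_left hαη hd
  -- `e^x − 1 ≤ 2x` on `[0, 1]` (Mathlib's `Real.abs_exp_sub_one_le`; the named form lives in `Literature/NumberTheory/Sieve`, not imported here)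
  have hx0 : 0 ≤ ((d + 1 : ℕ) : ℝ) * α := by positivity
  have h2 : Real.exp ((d + 1 : ℕ) * α) - 1 ≤ 2 * (((d + 1 : ℕ) : ℝ) * α) := by
    have h := Real.abs_exp_sub_one_le (x := ((d + 1 : ℕ) : ℝ) * α) (by rw [abs_of_nonneg hx0]; exact h1.trans hη)
    rw [abs_of_nonneg hx0] at h
    exact (le_abs_self _).trans h
  linarith

/-- `e^{(d+1)α} − 1 ≤ 2` under the same smallness. [folklore] -/
theorem exp_mul_sub_one_le_two (d : ℕ) {α η : ℝ} (hα : 0 ≤ α) (hαη : α ≤ η) (hη : (d + 1 : ℝ) * η ≤ 1) :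
    Real.exp ((d + 1 : ℕ) * α) - 1 ≤ 2 :=
  (exp_mul_sub_one_le d hα hαη hη).trans (by linarith)

/-- `e^{(d+1)α} − 1 ≤ η′` whenever `2(d+1)η ≤ η′` (the `hτη` input shape of `GaugeTermThreshold.gaugeSlot_small_of_le`). [folklore] -/
theorem exp_mul_sub_one_le_of (d : ℕ) {α η η' : ℝ} (hα : 0 ≤ α) (hαη : α ≤ η) (hη : (d + 1 : ℝ) * η ≤ 1) (hη' : 2 * ((d + 1 : ℝ) * η) ≤ η') :
    Real.exp ((d + 1 : ℕ) * α) - 1 ≤ η' :=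
  (exp_mul_sub_one_le d hα hαη hη).trans hη'

/-- **`card o·(e^{(d+1)α} − 1) ≤ η·(2·card o·(d+1))`** (the `epsR ≤ …` input of the t = 1 face). [folklore] -/
theorem card_mul_exp_sub_one_le (o : Type*) [Fintype o] (d : ℕ) {α η : ℝ} (hα : 0 ≤ α) (hαη : α ≤ η) (hη : (d + 1 : ℝ) * η ≤ 1) :
    Fintype.card o * (Real.exp ((d + 1 : ℕ) * α) - 1) ≤ η * (2 * Fintype.card o * (d + 1)) := by
  have hm : (0 : ℝ) ≤ Fintype.card o := Nat.cast_nonneg _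
  calc Fintype.card o * (Real.exp ((d + 1 : ℕ) * α) - 1) ≤ Fintype.card o * (2 * ((d + 1 : ℝ) * η)) :=
        mul_le_mul_of_nonneg_left (exp_mul_sub_one_le d hα hαη hη) hm
    _ = η * (2 * Fintype.card o * (d + 1)) := by ring

end Summit.QuantumFields.BalabanUV.T4Continuum.RegularTransportSize
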